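import Summits.QuantumFields.YangMills.Theorems.DirichletWindowAllSidesChessboardEvenTranslate
import HarnessLib

/-!
# The twisted two-class chessboard estimate on a block torus of EVEN side — the walks

Support file for item stmt-QuantumFields-20194 (`DirichletWindow.AllSidesCouplingChessboard`, K1 of the large-field
sparsity line; seat ym-dw-p1 g3).  Part 3 (parts 1, 2: `…EvenCore`, `…EvenTranslate`; the estimate itself: `…Even`).

For a family `A = (A_o)_{o ∈ O}` of sets of blocks of the even torus `(ℤ/N)^d` and an axis `i`, the components are of
two kinds (`cls i o`: slab-type, else layer-type).  The LINK pair of the boundary `k` symmetrises layer-type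
components with the tree's open symmetrisations `symP/symM i k` and slab-type components with the site-type closed
symmetrisations `ssymP/ssymM i (k-1)`; the SITE pair through `k` symmetrises layer-type components with
`ssymP/ssymM i k` and slab-type ones with `symP/symM i k`.  If a functional `ψ ≥ 0` with `ψ ⊤ > 0` obeys the reflection
Cauchy–Schwarz inequality for every LINK pair and every SITE pair of every axis, and `ψ (cylinder over T) ≤ ψ ⊤ ^ #T`,
then `ψ A ^ (N^d) ≤ ψ ⊤ ^ (∑_o #(A o))` (`twisted_chessboard_pow_le_even`) and `ψ A ≤ ψ ⊤ ^ (size A / N^d)`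
(`twisted_chessboard_le_rpow_even`); for a translation-invariant `ψ` the two BASE pairs (link `k = 1`, site `k = 0`)
suffice (`twisted_chessboard_le_rpow_even_of_base`).

Proof: maximisation of `Φ A = ψ A ^ (N^d) / ψ ⊤ ^ size A`; the positive member of each pair keeps maximisers
maximisers (exponent counts of parts 1 and of the tree); along one axis the open run-doubling walk (`even_walk`, only
positive open moves `oplus k`) is run on the layer-type slices with LINK moves (the slab-type slices ride along under
site-type moves, which keep constants constant), then on the slab-type slices with SITE moves; cylinders along earlier
axes are preserved; after `d` axes every component is `∅` or `univ`.  This is the even-side twin of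
`…AllSidesChessboardTwistedOdd`; finite combinatorics and real arithmetic only.

References: J. Fröhlich, R. Israel, E. H. Lieb, B. Simon, Comm. Math. Phys. 62 (1978) 1–34, Thm. 2.2/4.1; J. Fröhlich,
E. H. Lieb, Comm. Math. Phys. 60 (1978) 233–267, Thm. 2.2/2.3.  Nothing here is a statement about the Yang–Mills gap.
-/

noncomputable section

open Finset
open Literature.Barriers.CriticalPhenomena.NonGibbs
open Literature.Probability.LatticeModels

namespace Summit.QuantumFields.YangMills.Theorems.AllSidesChessboard

/-! ### §1. The open run-doubling walk on the even cycle -/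

section Walk

variable {N : ℕ} [NeZero N] {ι : Type*}

/-- The value of `t - k` when `t₀ - t = u`, `k = t₀ - (ℓ - 1)`, `u < ℓ ≤ N`: it is `ℓ - 1 - u`. -/
theorem val_sub_of_run {t₀ t : ZMod N} {u ℓ : ℕ} (hu : (t₀ - t).val = u) (huℓ : u < ℓ) (hℓ : ℓ ≤ N) :
    (t - (t₀ - ((ℓ - 1 : ℕ) : ZMod N))).val = ℓ - 1 - u := by
  have h1 : ((u : ℕ) : ZMod N) = t₀ - t := by rw [← hu, ZMod.natCast_zmod_val]
  have h : t - (t₀ - ((ℓ - 1 : ℕ) : ZMod N)) = (((ℓ - 1 - u : ℕ) : ZMod N)) := by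
    rw [Nat.cast_sub (show u ≤ ℓ - 1 by omega), h1]
    ring
  rw [h, ZMod.val_natCast, Nat.mod_eq_of_lt (by omega)]

/-- **The open run-doubling walk on the even cycle.**  A property of assignments of `ℤ/N`, `N` even, stable under all
open plus-moves `oplus k` passes from an assignment to each of its constant assignments. -/
theorem even_walk (hN : Even N) {P : (ZMod N → ι) → Prop} (hplus : ∀ (k : ZMod N) (σ : ZMod N → ι), P σ → P (oplus k σ))
    {σ : ZMod N → ι} (hσ : P σ) (t₀ : ZMod N) : P (fun _ => σ t₀) := by
  obtain ⟨m, hm⟩ := hN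
  have hN0 : N ≠ 0 := NeZero.ne N
  have hm1 : 1 ≤ m := by omega
  have hN2 : N / 2 = m := by omega
  -- the reflected step: for a run of length `ℓ ≤ m` ending at `t₀` and `k = t₀ - (ℓ - 1)`, a point `t` with
  -- `ℓ ≤ (t₀ - t).val < 2ℓ` is outside the open half of `k` and its mirror `2k - 1 - t` is inside the run
  have mirror : ∀ (ℓ : ℕ), 1 ≤ ℓ → ℓ ≤ m → ∀ t : ZMod N, ℓ ≤ (t₀ - t).val → (t₀ - t).val < 2 * ℓ →
      ¬ ((t - (t₀ - ((ℓ - 1 : ℕ) : ZMod N))).val < N / 2) ∧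
        (t₀ - (2 * (t₀ - ((ℓ - 1 : ℕ) : ZMod N)) - 1 - t)).val < ℓ := by
    intro ℓ hℓ1 hℓm t hu ht
    have hlt := ZMod.val_lt (t₀ - t)
    have hℓc : ((ℓ - 1 : ℕ) : ZMod N) = (ℓ : ZMod N) - 1 := by rw [Nat.cast_sub hℓ1, Nat.cast_one]
    have hval : (((t₀ - t).val : ℕ) : ZMod N) = t₀ - t := ZMod.natCast_zmod_val _
    constructor
    · have h : t - (t₀ - ((ℓ - 1 : ℕ) : ZMod N)) = -((((t₀ - t).val - (ℓ - 1) : ℕ) : ZMod N)) := by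
        rw [Nat.cast_sub (show ℓ - 1 ≤ (t₀ - t).val by omega), hval]
        ring
      rw [h, ZMod.neg_val, if_neg, ZMod.val_natCast, Nat.mod_eq_of_lt (by omega)]
      · omega
      · intro h0
        rw [ZMod.natCast_eq_zero_iff] at h0
        have := Nat.le_of_dvd (by omega) h0
        omega
    · have h : t₀ - (2 * (t₀ - ((ℓ - 1 : ℕ) : ZMod N)) - 1 - t) = (((2 * ℓ - 1 - (t₀ - t).val : ℕ) : ZMod N)) := by
        rw [Nat.cast_sub (show (t₀ - t).val ≤ 2 * ℓ - 1 by omega), Nat.cast_sub (show 1 ≤ 2 * ℓ by omega), hval,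
          hℓc]
        push_cast
        ring
      rw [h, ZMod.val_natCast, Nat.mod_eq_of_lt (by omega)]
      omega
  -- doubling a run `τ t = σ t₀` for `(t₀ - t).val < ℓ` into one of length `2ℓ`
  have double : ∀ ℓ : ℕ, 1 ≤ ℓ → ℓ ≤ m → ∀ τ : ZMod N → ι, P τ → (∀ t, (t₀ - t).val < ℓ → τ t = σ t₀) →
      ∃ τ' : ZMod N → ι, P τ' ∧ ∀ t, (t₀ - t).val < 2 * ℓ → τ' t = σ t₀ := by
    intro ℓ hℓ1 hℓm τ hτ hrun
    refine ⟨oplus (t₀ - ((ℓ - 1 : ℕ) : ZMod N)) τ, hplus _ τ hτ, fun t ht => ?_⟩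
    unfold oplus
    by_cases hu : (t₀ - t).val < ℓ
    · have hv : (t - (t₀ - ((ℓ - 1 : ℕ) : ZMod N))).val = ℓ - 1 - (t₀ - t).val := val_sub_of_run rfl hu (by omega)
      rw [if_pos (by rw [hv, hN2]; omega)]
      exact hrun t hu
    · obtain ⟨h1, h2⟩ := mirror ℓ hℓ1 hℓm t (not_lt.1 hu) ht
      rw [if_neg h1]
      exact hrun _ h2
  -- iterate: runs of length `min (2^j) m`
  have grow : ∀ j : ℕ, ∃ τ : ZMod N → ι, P τ ∧ ∀ t, (t₀ - t).val < min (2 ^ j) m → τ t = σ t₀ := by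
    intro j
    induction j with
    | zero =>
      refine ⟨σ, hσ, fun t ht => ?_⟩
      have h := lt_of_lt_of_le ht (min_le_left _ _)
      rw [pow_zero, Nat.lt_one_iff, ZMod.val_eq_zero, sub_eq_zero] at h
      rw [h]
    | succ j ih =>
      obtain ⟨τ, hτ, hrun⟩ := ih
      by_cases hj : 2 ^ j ≤ m
      · rw [min_eq_left hj] at hrun
        obtain ⟨τ', hτ', hrun'⟩ := double (2 ^ j) Nat.one_le_two_pow hj τ hτ hrun
        refine ⟨τ', hτ', fun t ht => hrun' t (lt_of_lt_of_le ht ?_)⟩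
        exact (min_le_left _ _).trans (by rw [pow_succ]; omega)
      · refine ⟨τ, hτ, fun t ht => hrun t (lt_of_lt_of_le ht ?_)⟩
        rw [min_eq_right (show m ≤ 2 ^ j by omega)]
        exact min_le_right _ _
  -- a run of length `m` ending at `t₀`; the open plus-move at `t₀ - (m - 1)` makes everything constant
  obtain ⟨j, hj⟩ : ∃ j : ℕ, m ≤ 2 ^ j := ⟨m, (Nat.lt_two_pow_self).le⟩
  obtain ⟨τ, hτ, hrun⟩ := grow j
  rw [min_eq_right hj] at hrun
  set k : ZMod N := t₀ - ((m - 1 : ℕ) : ZMod N) with hk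
  have hfinal : oplus k τ = fun _ => σ t₀ := by
    funext t
    have hlt := ZMod.val_lt (t₀ - t)
    unfold oplus
    by_cases hu : (t₀ - t).val < m
    · have hv : (t - k).val = m - 1 - (t₀ - t).val := val_sub_of_run rfl hu (by omega)
      rw [if_pos (by rw [hv, hN2]; omega)]
      exact hrun t hu
    · obtain ⟨h1, h2⟩ := mirror m hm1 le_rfl t (not_lt.1 hu) (by omega)
      rw [if_neg h1]
      exact hrun _ h2
  rw [← hfinal]
  exact hplus k τ hτ

end Walk

/-! ### §2. The exponent counts of the LINK and SITE pairs and the functional `Φ` -/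

section Phi

variable {d N : ℕ} [NeZero N] {O : Type*} [Fintype O] (cls : Fin d → O → Bool)
  (ψ : (O → Finset (BlockIdx d N)) → ℝ)

/-- **Exponent count of the LINK pair** on the even torus. -/
theorem size_link_pair (hN : Even N) (i : Fin d) (k : ZMod N) (A : O → Finset (BlockIdx d N)) :
    (∑ o, #(if cls i o then ssymP i (k - 1) (A o) else symP i k (A o))) +
        (∑ o, #(if cls i o then ssymM i (k - 1) (A o) else symM i k (A o))) = 2 * ∑ o, #(A o) := by
  rw [← sum_add_distrib, mul_sum]
  refine sum_congr rfl fun o _ => ?_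
  cases cls i o
  · simpa using card_symP_add_card_symM hN i k (A o)
  · simpa using card_ssymP_add_card_ssymM hN i (k - 1) (A o)

/-- **Exponent count of the SITE pair** on the even torus. -/
theorem size_site_pair (hN : Even N) (i : Fin d) (k : ZMod N) (A : O → Finset (BlockIdx d N)) :
    (∑ o, #(if cls i o then symP i k (A o) else ssymP i k (A o))) +
        (∑ o, #(if cls i o then symM i k (A o) else ssymM i k (A o))) = 2 * ∑ o, #(A o) := by
  rw [← sum_add_distrib, mul_sum]
  refine sum_congr rfl fun o _ => ?_
  cases cls i o
  · simpa using card_ssymP_add_card_ssymM hN i k (A o)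
  · simpa using card_symP_add_card_symM hN i k (A o)

/-- The normalised functional `Φ A = ψ A ^ (N^d) / ψ ⊤ ^ (∑_o #(A o))` (even side). -/
def ePhi (A : O → Finset (BlockIdx d N)) : ℝ :=
  ψ A ^ (N ^ d) / ψ (fun _ => univ) ^ (∑ o, #(A o))

/-- `Φ ≥ 0`. -/
theorem ePhi_nonneg (h0 : ∀ A, 0 ≤ ψ A) (A : O → Finset (BlockIdx d N)) : 0 ≤ ePhi ψ A :=
  div_nonneg (pow_nonneg (h0 A) _) (pow_nonneg (h0 _) _)

/-- **A Cauchy–Schwarz pair with matching exponents keeps the positive member of a maximiser a maximiser.** -/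
theorem ePhi_eq_of_isMax_of_pair (h0 : ∀ A, 0 ≤ ψ A) (h1 : 0 < ψ fun _ => univ)
    {A P M' : O → Finset (BlockIdx d N)} (hcs : ψ A ^ 2 ≤ ψ P * ψ M')
    (hsize : (∑ o, #(P o)) + (∑ o, #(M' o)) = 2 * ∑ o, #(A o))
    {M : ℝ} (hMpos : 0 < M) (hmax : ∀ B, ePhi ψ B ≤ M) (hA : ePhi ψ A = M) : ePhi ψ P = M := by
  have hpow : (ψ A ^ N ^ d) ^ 2 ≤ ψ P ^ N ^ d * ψ M' ^ N ^ d := by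
    rw [← pow_mul, mul_comm, pow_mul, ← mul_pow]
    exact pow_le_pow_left₀ (sq_nonneg _) hcs _
  have hden : ψ (fun _ => univ) ^ (∑ o, #(P o)) * ψ (fun _ => univ) ^ (∑ o, #(M' o)) =
      (ψ (fun _ => univ) ^ (∑ o, #(A o))) ^ 2 := by
    rw [← pow_add, hsize, pow_mul']
  have h : ePhi ψ A ^ 2 ≤ ePhi ψ P * ePhi ψ M' := by
    simp only [ePhi, div_pow]
    rw [div_mul_div_comm, hden]
    exact div_le_div_of_nonneg_right hpow (by positivity)
  rw [hA] at h
  have hP0 := ePhi_nonneg ψ h0 P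
  have hPle := hmax P
  have hMle := hmax M'
  refine le_antisymm hPle ?_
  by_contra hlt
  rw [not_le] at hlt
  nlinarith [mul_le_mul_of_nonneg_left hMle hP0, mul_lt_mul_of_pos_right hlt hMpos]

end Phi

/-! ### §3. Growing a maximiser along one axis: the two-phase walk (even side) -/

section TwoPhase

variable {d N : ℕ} [NeZero N] {O : Type*} (cls : Fin d → O → Bool)

/-- **Gluing the LINK plus-move** (open plus-move at `k` on the layer-type slices, site-type plus-move through `k - 1` on
the slab-type slices) **is the positive LINK symmetrisation of the glued family.** -/
theorem glue_linkPlus (hN : Even N) (i : Fin d) (k : ZMod N) (σ : ZMod N → O → Finset (BlockIdx d N)) :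
    (fun o => glueSlices i (fun t =>
        if cls i o then splus (k - 1) (fun t => σ t o) t else oplus k (fun t => σ t o) t)) =
      fun o => if cls i o then ssymP i (k - 1) (glueSlices i fun t => σ t o)
        else symP i k (glueSlices i fun t => σ t o) := by
  funext o
  cases cls i o
  · simp only [Bool.false_eq_true, ↓reduceIte]
    exact glue_oplus hN i k _
  · simp only [↓reduceIte]
    exact glue_splus hN i (k - 1) _

/-- **Gluing the SITE plus-move is the positive SITE symmetrisation of the glued family.** -/
theorem glue_sitePlus (hN : Even N) (i : Fin d) (k : ZMod N) (σ : ZMod N → O → Finset (BlockIdx d N)) :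
    (fun o => glueSlices i (fun t =>
        if cls i o then oplus k (fun t => σ t o) t else splus k (fun t => σ t o) t)) =
      fun o => if cls i o then symP i k (glueSlices i fun t => σ t o)
        else ssymP i k (glueSlices i fun t => σ t o) := by
  funext o
  cases cls i o
  · simp only [Bool.false_eq_true, ↓reduceIte]
    exact glue_splus hN i k _
  · simp only [↓reduceIte]
    exact glue_oplus hN i k _

/-- **Growing a maximiser along the axis `i` (even side, two-phase open walk).**  If `P` is stable under the positive
LINK symmetrisation of every boundary and the positive SITE symmetrisation through every block of the axis `i`, then
from any family with `P` one reaches a family with `P` all of whose components are cylinders along `i`. -/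
theorem exists_cyl_of_stable_even (hN : Even N) {P : (O → Finset (BlockIdx d N)) → Prop} (i : Fin d)
    (hLk : ∀ (k : ZMod N) A, P A →
      P (fun o => if cls i o then ssymP i (k - 1) (A o) else symP i k (A o)))
    (hSk : ∀ (k : ZMod N) A, P A →
      P (fun o => if cls i o then symP i k (A o) else ssymP i k (A o)))
    {A : O → Finset (BlockIdx d N)} (hA : P A) :
    ∃ A' : O → Finset (BlockIdx d N), P A' ∧
      ∀ o, ∀ c ∈ A' o, ∀ t : ZMod N, Function.update c i t ∈ A' o := by
  classical
  let glue : (ZMod N → O → Finset (BlockIdx d N)) → O → Finset (BlockIdx d N) :=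
    fun σ o => glueSlices i fun t => σ t o
  have hglueL : ∀ (k : ZMod N) σ, P (glue σ) → P (glue fun t o =>
      if cls i o then splus (k - 1) (fun t => σ t o) t else oplus k (fun t => σ t o) t) := by
    intro k σ hσ
    have h := glue_linkPlus cls hN i k σ
    change glue _ = _ at h
    rw [h]; exact hLk k _ hσ
  have hglueS : ∀ (k : ZMod N) σ, P (glue σ) → P (glue fun t o =>
      if cls i o then oplus k (fun t => σ t o) t else splus k (fun t => σ t o) t) := by
    intro k σ hσ
    have h := glue_sitePlus cls hN i k σ
    change glue _ = _ at h
    rw [h]; exact hSk k _ hσ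
  let σ₀ : ZMod N → O → Finset (BlockIdx d N) := fun t o => (A o).filter fun c => c i = t
  have hσ₀ : glue σ₀ = A := by
    funext o; exact glueSlices_slices i (A o)
  -- PHASE 1: layer-type components constant, by LINK moves
  have phase1 : ∃ σ₁ : ZMod N → O → Finset (BlockIdx d N), P (glue σ₁) ∧
      ∀ o, cls i o = false → ∀ t, σ₁ t o = σ₀ 0 o := by
    have key := even_walk hN
      (P := fun τ : ZMod N → O → Finset (BlockIdx d N) =>
        ∃ σ, P (glue σ) ∧ ∀ o, cls i o = false → ∀ t, σ t o = τ t o)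
      (fun k τ ⟨σ, hσ, hστ⟩ => ⟨_, hglueL k σ hσ, fun o ho t => by
        simp only [ho, Bool.false_eq_true, ↓reduceIte, oplus]
        split_ifs <;> exact hστ o ho _⟩)
      (σ := σ₀) ⟨σ₀, by rw [hσ₀]; exact hA, fun _ _ _ => rfl⟩ 0
    obtain ⟨σ₁, hσ₁, h⟩ := key
    exact ⟨σ₁, hσ₁, h⟩
  obtain ⟨σ₁, hσ₁P, hσ₁c⟩ := phase1
  -- PHASE 2: slab-type components constant, by SITE moves (layer-type ones stay constant)
  have phase2 : ∃ σ₂ : ZMod N → O → Finset (BlockIdx d N), P (glue σ₂) ∧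
      (∀ o, cls i o = false → ∀ t, σ₂ t o = σ₀ 0 o) ∧ ∀ o, cls i o = true → ∀ t, σ₂ t o = σ₁ 0 o := by
    have key := even_walk hN
      (P := fun τ : ZMod N → O → Finset (BlockIdx d N) =>
        ∃ σ, P (glue σ) ∧ (∀ o, cls i o = false → ∀ t, σ t o = σ₀ 0 o) ∧
          ∀ o, cls i o = true → ∀ t, σ t o = τ t o)
      (fun k τ ⟨σ, hσ, hσc, hστ⟩ => ⟨_, hglueS k σ hσ, fun o ho t => by
          simp only [ho, Bool.false_eq_true, ↓reduceIte]
          have hconst : (fun t => σ t o) = fun _ => σ₀ 0 o := funext (hσc o ho)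
          rw [hconst, splus_const],
        fun o ho t => by
          simp only [ho, ↓reduceIte, oplus]
          split_ifs <;> exact hστ o ho _⟩)
      (σ := σ₁) ⟨σ₁, hσ₁P, hσ₁c, fun _ _ _ => rfl⟩ 0
    obtain ⟨σ₂, hσ₂, h1, h2⟩ := key
    exact ⟨σ₂, hσ₂, h1, h2⟩
  obtain ⟨σ₂, hσ₂P, hσ₂c, hσ₂c'⟩ := phase2
  refine ⟨glue σ₂, hσ₂P, fun o => ?_⟩
  have hconst : (fun t => σ₂ t o) = fun _ => σ₂ 0 o := by
    funext t
    cases h : cls i o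
    · rw [hσ₂c o h t, hσ₂c o h 0]
    · rw [hσ₂c' o h t, hσ₂c' o h 0]
  change ∀ c ∈ glueSlices i (fun t => σ₂ t o), ∀ t, Function.update c i t ∈ glueSlices i (fun t => σ₂ t o)
  rw [hconst]
  exact cyl_glueSlices_const i _

end TwoPhase

end Summit.QuantumFields.YangMills.Theorems.AllSidesChessboard

end
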